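import Literature.NumberTheory.LFunctions.GaussianHeckeZeroCount
import HarnessLib

/-!
# Well-spaced representatives of the zeros of `L(s, λ^m)` in a box

Topic `Literature/NumberTheory/LFunctions`.  Everything in this file is PROVED; no definitions, no named
facts.  The standard reduction of a zero count WITH MULTIPLICITY to the cardinality of a set of zeros with
pairwise `≥ 1`-separated ordinates (Ivić 1985, (11.12): "we may choose the zeros so that the imaginary
parts differ from each other by at least 1"), for the Hecke `L`-functions `D_m = 4 L(·, λ^m)` of `ℚ(i)`:

* `GaussianHecke.exists_wellSpaced_representatives` — with the absolute `A` of the unit-window count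
  `GaussianHecke.exists_sum_window_le` (`≤ A log(|τ| + 2m + 6)` zeros with `β ≥ 1/2`, `|γ − τ| ≤ 1/2`):
  for `m ≥ 1`, `σ ≥ 1/2`, `T ≥ 0` there is a finite set `Z` of zeros of `D_m` with `Re ρ ≥ σ`,
  `|Im ρ| < T`, ordinates pairwise `≥ 1` apart, and
  `zeroCountIn m σ T ≤ 2A log(T + 2m + 8) · #Z`
  (group the zeros by `⌊Im ρ⌋`, bound each group by the window count, pick one zero per group and keep
  the larger parity class of `⌊Im ρ⌋`).

## References

* A. Ivić, *The Riemann Zeta-Function*, Wiley 1985, §11.2 (11.11)–(11.12). [Ivic1985]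
-/

noncomputable section

open Complex Finset Real

namespace Literature.NumberTheory.LFunctions

namespace GaussianHecke

/-- Two integers of the same parity that differ are `≥ 2` apart. [folklore] -/
theorem two_le_abs_sub_of_even_sub {k k' : ℤ} (h : Even (k - k')) (hne : k ≠ k') : 2 ≤ |k - k'| := by
  obtain ⟨r, hr⟩ := h
  rw [hr, show r + r = 2 * r by ring, abs_mul, abs_two]
  have : r ≠ 0 := by rintro rfl; simp at hr; exact hne (by linarith)
  have : 1 ≤ |r| := Int.one_le_abs this
  linarith

/-- Zeros whose ordinates have floors `≥ 2` apart have ordinates `≥ 1` apart. [folklore] -/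
theorem one_le_abs_sub_of_floor {x y : ℝ} (h : 2 ≤ |⌊x⌋ - ⌊y⌋|) : 1 ≤ |x - y| := by
  have hfl := Int.floor_le x
  have hlt := Int.lt_floor_add_one x
  have hfl' := Int.floor_le y
  have hlt' := Int.lt_floor_add_one y
  have h2 : (2 : ℝ) ≤ |((⌊x⌋ : ℤ) : ℝ) - ⌊y⌋| := by exact_mod_cast h
  rcases le_total ((⌊x⌋ : ℤ) : ℝ) ⌊y⌋ with hle | hle
  · rw [abs_of_nonpos (by linarith)] at h2
    rw [abs_of_nonpos (by linarith)]
    linarith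
  · rw [abs_of_nonneg (by linarith)] at h2
    rw [abs_of_nonneg (by linarith)]
    linarith

/-- **Well-spaced representatives** (see the module docstring). [cite: Ivic1985, §11.2 (11.12)] -/
theorem exists_wellSpaced_representatives :
    ∃ A : ℝ, 0 < A ∧ ∀ m : ℕ, m ≠ 0 → ∀ (σ T : ℝ), 1 / 2 ≤ σ → 0 ≤ T →
      ∃ Z : Finset ℂ, (∀ ρ ∈ Z, heckeL m ρ = 0 ∧ σ ≤ ρ.re ∧ |ρ.im| < T) ∧
        (∀ ρ ∈ Z, ∀ ρ' ∈ Z, ρ ≠ ρ' → 1 ≤ |ρ.im - ρ'.im|) ∧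
        (zeroCountIn m σ T : ℝ) ≤ 2 * A * Real.log (T + 2 * m + 8) * Z.card := by
  obtain ⟨A, hA, hwin⟩ := exists_sum_window_le
  refine ⟨A, hA, fun m hm σ T hσ hT ↦ ?_⟩
  classical
  set D := (zeroBox_finite hm σ T).toFinset with hD
  have hDmem : ∀ ρ ∈ D, heckeL m ρ = 0 ∧ σ ≤ ρ.re ∧ |ρ.im| < T := fun ρ hρ ↦ by
    rw [hD, Set.Finite.mem_toFinset] at hρ; exact hρ
  have hcount : (zeroCountIn m σ T : ℝ) = ∑ ρ ∈ D, ((analyticOrderAt (heckeL m) ρ).toNat : ℝ) := by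
    rw [zeroCountIn_eq_sum hm, Nat.cast_sum]
  -- group by `k = ⌊Im ρ⌋`
  set f : ℂ → ℤ := fun ρ ↦ ⌊ρ.im⌋ with hf
  set Kset := D.image f with hKset
  have hm0 : (0 : ℝ) ≤ m := Nat.cast_nonneg m
  have hfib : ∀ k ∈ Kset, ∑ ρ ∈ D.filter (fun ρ ↦ f ρ = k), ((analyticOrderAt (heckeL m) ρ).toNat : ℝ) ≤
      A * Real.log (T + 2 * m + 8) := by
    intro k hk
    set τ : ℝ := (k : ℝ) + 1 / 2 with hτ
    have hτT : |τ| ≤ T + 2 := by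
      rw [hKset, mem_image] at hk
      obtain ⟨ρ, hρ, rfl⟩ := hk
      have h1 := (hDmem ρ hρ).2.2
      rw [abs_lt] at h1
      have hfl := Int.floor_le ρ.im
      have hlt := Int.lt_floor_add_one ρ.im
      rw [hτ, abs_le]
      simp only [hf]
      constructor <;> linarith
    have h1 := hwin m hm τ (D.filter (fun ρ ↦ f ρ = k)) (fun ρ hρ ↦ by
      rw [mem_filter] at hρ
      obtain ⟨h0, h1, -⟩ := hDmem ρ hρ.1
      refine ⟨h0, hσ.trans h1, ?_⟩
      have hfl := Int.floor_le ρ.im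
      have hlt := Int.lt_floor_add_one ρ.im
      have hk' : (⌊ρ.im⌋ : ℝ) = k := by exact_mod_cast hρ.2
      rw [hτ, abs_le, ← hk']
      constructor <;> linarith)
    refine h1.trans (mul_le_mul_of_nonneg_left (Real.log_le_log (by positivity) (by linarith)) hA.le)
  -- a section of `f` on `Kset` and the two parity classes
  have hex : ∀ k ∈ Kset, ∃ ρ ∈ D, f ρ = k := fun k hk ↦ by simpa [hKset, mem_image] using hk
  choose! g hgD hgf using hex
  have hginj : Set.InjOn g ↑Kset := by
    intro k hk k' hk' h
    rw [← hgf k hk, ← hgf k' hk', h]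
  have hclass : ∀ P : Finset ℤ, P ⊆ Kset → (∀ k ∈ P, ∀ k' ∈ P, k ≠ k' → 2 ≤ |k - k'|) →
      (∀ ρ ∈ P.image g, heckeL m ρ = 0 ∧ σ ≤ ρ.re ∧ |ρ.im| < T) ∧
      (∀ ρ ∈ P.image g, ∀ ρ' ∈ P.image g, ρ ≠ ρ' → 1 ≤ |ρ.im - ρ'.im|) ∧ (P.image g).card = P.card := by
    intro P hP hP2
    refine ⟨fun ρ hρ ↦ ?_, fun ρ hρ ρ' hρ' hne ↦ ?_, card_image_of_injOn (hginj.mono hP)⟩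
    · rw [mem_image] at hρ
      obtain ⟨k, hk, rfl⟩ := hρ
      exact hDmem _ (hgD k (hP hk))
    · rw [mem_image] at hρ hρ'
      obtain ⟨k, hk, rfl⟩ := hρ
      obtain ⟨k', hk', rfl⟩ := hρ'
      have hkk : k ≠ k' := fun h ↦ hne (by rw [h])
      have h2 := hP2 k hk k' hk' hkk
      have e1 : ⌊(g k).im⌋ = k := hgf k (hP hk)
      have e2 : ⌊(g k').im⌋ = k' := hgf k' (hP hk')
      refine one_le_abs_sub_of_floor ?_
      rw [e1, e2]; exact h2
  set E := Kset.filter (fun k ↦ Even k) with hE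
  set O := Kset.filter (fun k ↦ ¬ Even k) with hO
  have hE2 : ∀ k ∈ E, ∀ k' ∈ E, k ≠ k' → 2 ≤ |k - k'| := by
    intro k hk k' hk' hne
    rw [hE, mem_filter] at hk hk'
    exact two_le_abs_sub_of_even_sub (Int.even_sub.2 (iff_of_true hk.2 hk'.2)) hne
  have hO2 : ∀ k ∈ O, ∀ k' ∈ O, k ≠ k' → 2 ≤ |k - k'| := by
    intro k hk k' hk' hne
    rw [hO, mem_filter] at hk hk'
    exact two_le_abs_sub_of_even_sub (Int.even_sub.2 (iff_of_false hk.2 hk'.2)) hne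
  obtain ⟨hEz, hEs, hEc⟩ := hclass E (filter_subset _ _) hE2
  obtain ⟨hOz, hOs, hOc⟩ := hclass O (filter_subset _ _) hO2
  have hsplit : Kset.card = E.card + O.card := (card_filter_add_card_filter_not (s := Kset) (fun k ↦ Even k)).symm
  -- the total count is at most `A log(…) · #Kset`
  have hmaps : ∀ ρ ∈ D, f ρ ∈ Kset := fun ρ hρ ↦ mem_image_of_mem f hρ
  have htot : (zeroCountIn m σ T : ℝ) ≤ A * Real.log (T + 2 * m + 8) * Kset.card := by
    rw [hcount, ← sum_fiberwise_of_maps_to hmaps]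
    calc ∑ k ∈ Kset, ∑ ρ ∈ D.filter (fun ρ ↦ f ρ = k), ((analyticOrderAt (heckeL m) ρ).toNat : ℝ)
        ≤ ∑ k ∈ Kset, A * Real.log (T + 2 * m + 8) := sum_le_sum hfib
      _ = A * Real.log (T + 2 * m + 8) * Kset.card := by rw [sum_const, nsmul_eq_mul]; ring
  have hlog0 : 0 ≤ A * Real.log (T + 2 * m + 8) := mul_nonneg hA.le (Real.log_nonneg (by linarith))
  -- keep the larger parity class
  rcases le_total O.card E.card with hle | hle
  · refine ⟨E.image g, hEz, hEs, ?_⟩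
    rw [hEc]
    have : (Kset.card : ℝ) ≤ 2 * E.card := by
      have : Kset.card ≤ 2 * E.card := by omega
      exact_mod_cast this
    calc (zeroCountIn m σ T : ℝ) ≤ A * Real.log (T + 2 * m + 8) * Kset.card := htot
      _ ≤ A * Real.log (T + 2 * m + 8) * (2 * E.card) := mul_le_mul_of_nonneg_left this hlog0
      _ = 2 * A * Real.log (T + 2 * m + 8) * E.card := by ring
  · refine ⟨O.image g, hOz, hOs, ?_⟩
    rw [hOc]
    have : (Kset.card : ℝ) ≤ 2 * O.card := by
      have : Kset.card ≤ 2 * O.card := by omega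
      exact_mod_cast this
    calc (zeroCountIn m σ T : ℝ) ≤ A * Real.log (T + 2 * m + 8) * Kset.card := htot
      _ ≤ A * Real.log (T + 2 * m + 8) * (2 * O.card) := mul_le_mul_of_nonneg_left this hlog0
      _ = 2 * A * Real.log (T + 2 * m + 8) * O.card := by ring

end GaussianHecke

end Literature.NumberTheory.LFunctions
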